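import Summits.Ventures.PercRepro.Night2FatDegFree
import Summits.Ventures.PercRepro.Night2FatZThreeB

/-!
# night-2: the witnesses of the singly degenerate regime — a side point and free points — the case |P₂| ≥ 2

For every lossy basis pair of the singly degenerate regime (the side points `M = π₃ ∖ L` collinear, the points of
`π₂` off the spine of rank `≥ 3`, the spine a class line), `W ∖ {x}` contains a side point `y₃` and either two free
points, or a second side point and one free point (**`exists_side_and_free_deg`**).  The basis points split as
`L₀ ∪ P₂ ∪ P₃` (on the spine / in `π₂` off it / side), `|L₀| ≤ 2`, `|L₀ ∪ P₂| ≤ 3`, `|P₃| ≤ 2`; the side points of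
`W ∖ {x}` number `|M| − |P₃| ≥ 1`; the free points come from `π₂` off the class basis lines through the basis
points of `π₂` (at most one class basis line through a basis point off the spine, `no_two_class_lines_through_off`)
or from the spine (`free_of_spine_point`), case by case on `|P₂| ∈ {0, 1, 2, 3}`.
Paper `proofs/NIGHT-2-g35.md` §4.
-/

namespace PercRepro.Shadow

open PercRepro.ThmH PercRepro.PerFlat

variable {α : Type*} [DecidableEq α] {M : Matroid α} [M.Finite] {G : Finset α}

/-- A side point and two free points, or two side points and a free point, when `|P₂| ≥ 2` (then `|L₀| ≤ 1`). -/
theorem deg_wit_large_case_p2_two {w₀ x : α} {R₁ : Finset α} {c₂ c₃ : α} {B : Finset α} {z : α}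
    (hd : (gr M \ G).card = 2) (hk : kColoops M G = 1) (hs : ∀ e ∈ gr M, ∀ f ∈ gr M, e ≠ f → rkN M {e, f} = 2)
    (hfat : (fatClosures M 5 G 2).card ≤ 1) (hR₁2 : rkN M R₁ = 2) (hR₁3 : 3 ≤ R₁.card)
    (hcop : rkN M (insert w₀ (insert x R₁)) ≤ 3)
    (hnd₂ : 3 ≤ rkN M (((G \ coloops M G) \ {w₀, x}).filter (fun e => e ∈ clF M (insert c₂ R₁) ∧ e ∉ clF M R₁)))
    (hdeg₃ : rkN M (((G \ coloops M G) \ {w₀, x}).filter (fun e => e ∈ clF M (insert c₃ R₁) ∧ e ∉ clF M R₁)) ≤ 2)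
    {V P W Mset P₃ M' L₀ P₂ Aset Lset : Finset α} (hV : V = (G \ coloops M G) \ {w₀, x})
    (hP : P = (insert z B \ coloops M G).erase w₀) (hW : W = (G \ insert z B).erase x)
    (hMset : Mset = V.filter (fun e => e ∈ clF M (insert c₃ R₁) ∧ e ∉ clF M R₁))
    (hP₃ : P₃ = P.filter (fun e => e ∈ Mset)) (hM' : M' = W.filter (fun e => e ∈ Mset))
    (hL₀ : L₀ = P.filter (fun e => e ∈ clF M R₁))
    (hP₂ : P₂ = P.filter (fun e => e ∈ clF M (insert c₂ R₁) ∧ e ∉ clF M R₁))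
    (hAset : Aset = V.filter (fun e => e ∈ clF M (insert c₂ R₁) ∧ e ∉ clF M R₁))
    (hLset : Lset = V.filter (fun e => e ∈ clF M R₁)) {y₃ : α} (hVg : V ⊆ gr M) (hPV : P ⊆ V) (hP4 : P.card = 4)
    (hR₁g : R₁ ⊆ gr M) (hM3 : 3 ≤ Mset.card) (hM2 : 1 < Mset.card) (hP₃2 : P₃.card ≤ 2)
    (hMsplit : Mset.card = P₃.card + M'.card) (hM'1 : 1 ≤ M'.card) (hL₀2 : L₀.card ≤ 2)
    (hπ₂3 : (P.filter (fun e => e ∈ clF M (insert c₂ R₁))).card ≤ 3) (hL₀P₂ : L₀.card + P₂.card ≤ 3)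
    (hsplit : L₀.card + P₂.card + P₃.card = 4) (hAW : ∀ e ∈ Aset, e ∉ P₂ → e ∈ W) (hL3 : 3 ≤ Lset.card)
    (hLW : ∀ e ∈ Lset, e ∉ L₀ → e ∈ W) (hLM : ∀ s ∈ Lset, ∀ s' ∈ Lset, s ≠ s' → s ∈ clF M Mset → s' ∉ clF M Mset)
    (hpencil : ∀ c ∈ P₂, ∀ a ∈ P, ∀ b ∈ P, c ≠ a → c ≠ b → a ≠ b → rkN M (insert w₀ (insert x {c, a})) ≤ 3 → rkN M
      (insert w₀ (insert x {c, b})) ≤ 3 → False)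
    (hspineM : ∀ a ∈ L₀, ∀ c ∈ P₂, rkN M ({a, c} ∪ Mset) ≤ 3 → a ∈ clF M Mset)
    (htwo : P₃.card ≤ 1 → ∃ y₃' ∈ W, y₃' ≠ y₃ ∧ (y₃' ∈ clF M (insert c₃ R₁) ∧ y₃' ∉ clF M R₁))
    (hfreeL : L₀.card ≤ 1 → ∀ s ∈ W, s ∈ clF M R₁ → s ∉ clF M Mset → (∀ c ∈ P₂, ∀ c' ∈ P₂, c ≠ c' → s ∈ clF M {c,
      c'} → rkN M (insert w₀ (insert x {c, c'})) ≤ 3 → 4 ≤ rkN M ({c, c'} ∪ Mset)) → s ∉ clF M Mset ∧ ∀ a ∈ P, ∀ b ∈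
      P, a ≠ b → s ∈ clF M {a, b} → rkN M (insert w₀ (insert x {a, b})) ≤ 3 → 4 ≤ rkN M ({a, b} ∪ Mset))
    (hfreeA : ∀ f ∈ Aset, f ∈ W → (∀ a ∈ L₀, ∀ c ∈ P₂, a ≠ c → f ∈ clF M {a, c} → rkN M (insert w₀ (insert x {a,
      c})) ≤ 3 → 4 ≤ rkN M ({a, c} ∪ Mset)) → (∀ c ∈ P₂, ∀ c' ∈ P₂, c ≠ c' → f ∈ clF M {c, c'} → rkN M (insert w₀
      (insert x {c, c'})) ≤ 3 → 4 ≤ rkN M ({c, c'} ∪ Mset)) → f ∉ clF M Mset ∧ ∀ a ∈ P, ∀ b ∈ P, a ≠ b → f ∈ clF M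
      {a, b} → rkN M (insert w₀ (insert x {a, b})) ≤ 3 → 4 ≤ rkN M ({a, b} ∪ Mset))
    (hAoff : ∀ X : Finset α, rkN M X ≤ 2 → ∃ f ∈ Aset, f ∉ clF M X) (hA3 : 3 ≤ Aset.card) (hP₂2 : 2 ≤ P₂.card) :
    ((∃ f₁ ∈ (G \ insert z B).erase x, ∃ f₂ ∈ (G \ insert z B).erase x, f₁ ≠ f₂ ∧ (f₁ ∉ clF M (((G \ coloops M G)
      \ {w₀, x}).filter (fun e => e ∈ clF M (insert c₃ R₁) ∧ e ∉ clF M R₁)) ∧ ∀ a ∈ (insert z B \ coloops M G).erase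
      w₀, ∀ b ∈ (insert z B \ coloops M G).erase w₀, a ≠ b → f₁ ∈ clF M {a, b} → rkN M (insert w₀ (insert x {a, b}))
      ≤ 3 → 4 ≤ rkN M ({a, b} ∪ ((G \ coloops M G) \ {w₀, x}).filter (fun e => e ∈ clF M (insert c₃ R₁) ∧ e ∉ clF M
      R₁))) ∧ (f₂ ∉ clF M (((G \ coloops M G) \ {w₀, x}).filter (fun e => e ∈ clF M (insert c₃ R₁) ∧ e ∉ clF M R₁))
      ∧ ∀ a ∈ (insert z B \ coloops M G).erase w₀, ∀ b ∈ (insert z B \ coloops M G).erase w₀, a ≠ b → f₂ ∈ clF M {a,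
      b} → rkN M (insert w₀ (insert x {a, b})) ≤ 3 → 4 ≤ rkN M ({a, b} ∪ ((G \ coloops M G) \ {w₀, x}).filter (fun e
      => e ∈ clF M (insert c₃ R₁) ∧ e ∉ clF M R₁)))) ∨ (∃ y₃' ∈ (G \ insert z B).erase x, y₃' ≠ y₃ ∧ (y₃' ∈ clF M
      (insert c₃ R₁) ∧ y₃' ∉ clF M R₁) ∧ ∃ f ∈ (G \ insert z B).erase x, f ∉ clF M (((G \ coloops M G) \ {w₀,
      x}).filter (fun e => e ∈ clF M (insert c₃ R₁) ∧ e ∉ clF M R₁)) ∧ ∀ a ∈ (insert z B \ coloops M G).erase w₀, ∀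
      b ∈ (insert z B \ coloops M G).erase w₀, a ≠ b → f ∈ clF M {a, b} → rkN M (insert w₀ (insert x {a, b})) ≤ 3 →
      4 ≤ rkN M ({a, b} ∪ ((G \ coloops M G) \ {w₀, x}).filter (fun e => e ∈ clF M (insert c₃ R₁) ∧ e ∉ clF M R₁)))) := by
  subst hV hP hW hMset hP₃ hM' hL₀ hP₂ hAset hLset
  set V := (G \ coloops M G) \ {w₀, x} with hV
  set P := (insert z B \ coloops M G).erase w₀ with hP
  set W := (G \ insert z B).erase x with hW
  set Mset := V.filter (fun e => e ∈ clF M (insert c₃ R₁) ∧ e ∉ clF M R₁) with hMset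
  set P₃ := P.filter (fun e => e ∈ Mset) with hP₃
  set M' := W.filter (fun e => e ∈ Mset) with hM'
  set L₀ := P.filter (fun e => e ∈ clF M R₁) with hL₀
  set P₂ := P.filter (fun e => e ∈ clF M (insert c₂ R₁) ∧ e ∉ clF M R₁) with hP₂
  set Aset := V.filter (fun e => e ∈ clF M (insert c₂ R₁) ∧ e ∉ clF M R₁) with hAset
  set Lset := V.filter (fun e => e ∈ clF M R₁) with hLset
  have _u := hd
  have _u := hk
  have _u := hfat
  have _u := hR₁2
  have _u := hR₁3
  have _u := hcop
  have _u := hnd₂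
  have _u := hdeg₃
  have _u := hP4
  have _u := hM3
  have _u := hM2
  have _u := hP₃2
  have _u := hMsplit
  have _u := hM'1
  have _u := hL₀2
  have _u := hπ₂3
  have _u := hL₀P₂
  have _u := hsplit
  have _u := hL3
  have _u := hA3
  have _u := hP₂2
  have hL₀1 : L₀.card ≤ 1 := by omega
  -- the class basis lines through two basis points of `π₂` off the spine: at most one is a class line
  have hoff : ∀ c ∈ P₂, ∀ c' ∈ P₂, c ≠ c' → rkN M (insert w₀ (insert x {c, c'})) ≤ 3 →
      ∀ c'' ∈ P₂, c'' ≠ c → c'' ≠ c' → ¬ rkN M (insert w₀ (insert x {c, c''})) ≤ 3 := by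
    intro c hc c' hc' hcc' hcls c'' hc'' h1 h2 hcls'
    exact hpencil c hc c' (Finset.mem_filter.1 hc').1 c'' (Finset.mem_filter.1 hc'').1 hcc' (Ne.symm h1)
      (Ne.symm h2) hcls hcls'
  -- a free spine point of `W` off a given line `X` of rank `≤ 2` (to be the single class basis line of `π₂ ∖ L`)
  -- and off `clF M`; we need `|Lset ∩ W| ≥ 3 − |L₀|` and at most one spine point in `clF M`, at most one in `X`
  have hLWcard : Lset.card ≤ (Lset.filter (fun e => e ∈ W)).card + L₀.card := by
    have hsplitL : Lset.card = (Lset.filter (fun e => e ∈ W)).card + (Lset.filter (fun e => ¬ e ∈ W)).card :=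
      (Finset.card_filter_add_card_filter_not (s := Lset) _).symm
    have hsub : Lset.filter (fun e => ¬ e ∈ W) ⊆ L₀ := by
      intro e he
      rw [Finset.mem_filter] at he
      by_contra heL₀
      exact he.2 (hLW e he.1 heL₀)
    have := Finset.card_le_card hsub
    omega
  -- at most one spine point on a line `{c, c'}` with `c ∈ π₂` off the spine
  have hLline : ∀ c ∈ P₂, ∀ c' ∈ P, c ≠ c' → ∀ s ∈ Lset, ∀ s' ∈ Lset, s ≠ s' → s ∈ clF M {c, c'} →
      s' ∉ clF M {c, c'} := by
    intro c hc c' hc' hcc' s hsL s' hs'L hss' hsX hs'X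
    have hcg : c ∈ gr M := hVg (hPV (Finset.mem_filter.1 hc).1)
    have hc'g : c' ∈ gr M := hVg (hPV hc')
    have hsg : s ∈ gr M := hVg (Finset.mem_filter.1 hsL).1
    have hs'g : s' ∈ gr M := hVg (Finset.mem_filter.1 hs'L).1
    have hXg : ({c, c'} : Finset α) ⊆ gr M := Finset.insert_subset hcg (Finset.singleton_subset_iff.2 hc'g)
    have hsub : ({s, s'} : Finset α) ⊆ clF M ({c, c'} : Finset α) := by
      intro e he
      rw [Finset.mem_insert, Finset.mem_singleton] at he
      rcases he with rfl | rfl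
      · exact hsX
      · exact hs'X
    have hcl : clF M ({s, s'} : Finset α) = clF M ({c, c'} : Finset α) :=
      clF_eq_clF_of_subset_clF_of_rkN_le hXg hsub (by rw [hs c hcg c' hc'g hcc', hs s hsg s' hs'g hss'])
    have hsubL : ({s, s'} : Finset α) ⊆ clF M R₁ := by
      intro e he
      rw [Finset.mem_insert, Finset.mem_singleton] at he
      rcases he with rfl | rfl
      · exact (Finset.mem_filter.1 hsL).2
      · exact (Finset.mem_filter.1 hs'L).2
    have hcl2 : clF M ({s, s'} : Finset α) = clF M R₁ :=
      clF_eq_clF_of_subset_clF_of_rkN_le hR₁g hsubL (by rw [hR₁2, hs s hsg s' hs'g hss'])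
    have hcin : c ∈ clF M ({s, s'} : Finset α) := by
      rw [hcl]
      exact subset_clF_of_subset_gr hXg (Finset.mem_insert_self _ _)
    rw [hcl2] at hcin
    exact (Finset.mem_filter.1 hc).2.2 hcin
  -- a free point of `π₂`, off the single class basis line of `π₂ ∖ L` if any: exists when no spine–off class
  -- line coplanar with `M` is present, i.e. when `L₀ ∩ clF M = ∅`
  rcases Nat.lt_or_ge P₂.card 3 with hP₂2' | hP₂3
  · -- `P₂ = {c, c'}`
    obtain ⟨c, c', hcc', hP₂eq⟩ := Finset.card_eq_two.1 (by omega : P₂.card = 2)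
    have hcmem : c ∈ P₂ := by rw [hP₂eq]; exact Finset.mem_insert_self _ _
    have hc'mem : c' ∈ P₂ := by rw [hP₂eq]; exact Finset.mem_insert_of_mem (Finset.mem_singleton_self _)
    have hcP : c ∈ P := (Finset.mem_filter.1 hcmem).1
    have hc'P : c' ∈ P := (Finset.mem_filter.1 hc'mem).1
    have hcg : c ∈ gr M := hVg (hPV hcP)
    have hc'g : c' ∈ gr M := hVg (hPV hc'P)
    have hmem : ∀ e ∈ P₂, e = c ∨ e = c' := fun e he => by
      rw [hP₂eq, Finset.mem_insert, Finset.mem_singleton] at he; exact he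
    -- a free spine point, off `clF M` and off `clF {c, c'}`, whenever `Lset ∩ W` has `≥ 3` points or
    -- (`≥ 2` points and one of the two exclusions is vacuous)
    have hspinefree : ∀ s ∈ W, s ∈ clF M R₁ → s ∉ clF M Mset →
        (s ∈ clF M {c, c'} → rkN M (insert w₀ (insert x {c, c'})) ≤ 3 → 4 ≤ rkN M ({c, c'} ∪ Mset)) →
        s ∉ clF M Mset ∧ ∀ a ∈ P, ∀ b ∈ P, a ≠ b → s ∈ clF M {a, b} → rkN M (insert w₀ (insert x {a, b})) ≤ 3 →
          4 ≤ rkN M ({a, b} ∪ Mset) := by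
      intro s hsW hsL hsM hX
      apply hfreeL hL₀1 s hsW hsL hsM
      intro d hd d' hd' hdd' hsdd hcls
      rcases hmem d hd with rfl | rfl <;> rcases hmem d' hd' with rfl | rfl
      · exact absurd rfl hdd'
      · exact hX hsdd hcls
      · rw [Finset.pair_comm] at hsdd hcls ⊢
        exact hX hsdd hcls
      · exact absurd rfl hdd'
    -- a free point of `π₂` off `clF {c, c'}`
    have hplanefree : ∀ f ∈ Aset, f ∉ clF M {c, c'} →
        (∀ a ∈ L₀, a ∈ clF M Mset → ∀ d ∈ P₂, f ∈ clF M {a, d} → ¬ rkN M (insert w₀ (insert x {a, d})) ≤ 3) →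
        f ∈ W ∧ (f ∉ clF M Mset ∧ ∀ a ∈ P, ∀ b ∈ P, a ≠ b → f ∈ clF M {a, b} →
          rkN M (insert w₀ (insert x {a, b})) ≤ 3 → 4 ≤ rkN M ({a, b} ∪ Mset)) := by
      intro f hf hfX hac
      have hXg : ({c, c'} : Finset α) ⊆ gr M := Finset.insert_subset hcg (Finset.singleton_subset_iff.2 hc'g)
      have hfP₂ : f ∉ P₂ := by
        intro h
        rcases hmem f h with rfl | rfl
        · exact hfX (subset_clF_of_subset_gr hXg (Finset.mem_insert_self _ _))
        · exact hfX (subset_clF_of_subset_gr hXg (Finset.mem_insert_of_mem (Finset.mem_singleton_self _)))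
      have hfW : f ∈ W := hAW f hf hfP₂
      refine ⟨hfW, hfreeA f hf hfW ?_ ?_⟩
      · intro a ha d hd had hfad hcls
        by_contra hcopl
        push Not at hcopl
        have haM : a ∈ clF M Mset := hspineM a ha d hd (by omega)
        exact hac a ha haM d hd hfad hcls
      · intro d hd d' hd' hdd' hfdd hcls
        exfalso
        rcases hmem d hd with rfl | rfl <;> rcases hmem d' hd' with rfl | rfl
        · exact hdd' rfl
        · exact hfX hfdd
        · rw [Finset.pair_comm] at hfdd; exact hfX hfdd
        · exact hdd' rfl
    rcases Nat.lt_or_ge L₀.card 1 with hL₀0 | hL₀1'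
    · -- `L₀ = ∅`, `|P₃| = 2`: two free points — one on the spine, one in `π₂`
      left
      have hL₀e : L₀ = ∅ := Finset.card_eq_zero.1 (by omega)
      have hnoL₀ : ∀ a, a ∉ L₀ := fun a ha => by rw [hL₀e] at ha; exact Finset.notMem_empty _ ha
      -- the spine point: `Lset ⊆ W` has `≥ 3` points; at most one in `clF M`, at most one in `clF {c, c'}`
      have hLWall : ∀ e ∈ Lset, e ∈ W := fun e he => hLW e he (hnoL₀ e)
      obtain ⟨s, hsL, hsM, hsX⟩ : ∃ s ∈ Lset, s ∉ clF M Mset ∧ s ∉ clF M {c, c'} := by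
        by_contra hcon
        push Not at hcon
        -- every spine point is in `clF M` or in `clF {c, c'}`: with three spine points two share one of them
        obtain ⟨s₁, hs₁, s₂, hs₂, s₃, hs₃, h12, h13, h23⟩ := Finset.two_lt_card.1 (by omega : 2 < Lset.card)
        rcases Classical.em (s₁ ∈ clF M Mset) with h1 | h1
        · rcases Classical.em (s₂ ∈ clF M Mset) with h2 | h2
          · exact hLM s₁ hs₁ s₂ hs₂ h12 h1 h2
          · have h2X := hcon s₂ hs₂ h2
            rcases Classical.em (s₃ ∈ clF M Mset) with h3 | h3
            · exact hLM s₁ hs₁ s₃ hs₃ h13 h1 h3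
            · exact hLline c hcmem c' hc'P hcc' s₂ hs₂ s₃ hs₃ h23 h2X (hcon s₃ hs₃ h3)
        · have h1X := hcon s₁ hs₁ h1
          rcases Classical.em (s₂ ∈ clF M Mset) with h2 | h2
          · rcases Classical.em (s₃ ∈ clF M Mset) with h3 | h3
            · exact hLM s₂ hs₂ s₃ hs₃ h23 h2 h3
            · exact hLline c hcmem c' hc'P hcc' s₁ hs₁ s₃ hs₃ h13 h1X (hcon s₃ hs₃ h3)
          · exact hLline c hcmem c' hc'P hcc' s₁ hs₁ s₂ hs₂ h12 h1X (hcon s₂ hs₂ h2)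
      have hsfree := hspinefree s (hLWall s hsL) (Finset.mem_filter.1 hsL).2 hsM (fun h => absurd h hsX)
      -- the plane point off `clF {c, c'}`
      obtain ⟨f, hf, hfX⟩ := hAoff {c, c'} (by rw [hs c hcg c' hc'g hcc'])
      have hffree := hplanefree f hf hfX (fun a ha => absurd ha (hnoL₀ a))
      have hfs : f ≠ s := by
        rintro rfl
        exact (Finset.mem_filter.1 hf).2.2 (Finset.mem_filter.1 hsL).2
      exact ⟨f, hffree.1, s, hLWall s hsL, hfs, hffree.2, hsfree⟩
    · -- `L₀ = {a}`, `|P₃| = 1`: two side points and one free point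
      right
      obtain ⟨y₃', hy₃'W, hyy, hy₃'side⟩ := htwo (by omega)
      refine ⟨y₃', hy₃'W, hyy, hy₃'side, ?_⟩
      obtain ⟨a, haL₀⟩ := Finset.card_eq_one.1 (by omega : L₀.card = 1)
      have hamem : a ∈ L₀ := by rw [haL₀]; exact Finset.mem_singleton_self a
      have haonly : ∀ e ∈ L₀, e = a := fun e he => by rw [haL₀, Finset.mem_singleton] at he; exact he
      have haP : a ∈ P := (Finset.mem_filter.1 hamem).1
      have haL : a ∈ clF M R₁ := (Finset.mem_filter.1 hamem).2
      have hag : a ∈ gr M := hVg (hPV haP)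
      by_cases hccls : rkN M (insert w₀ (insert x {c, c'})) ≤ 3
      · -- the line `{c, c'}` is a class line: no class line `{a, c}` or `{a, c'}`; a plane point off `{c, c'}`
        obtain ⟨f, hf, hfX⟩ := hAoff {c, c'} (by rw [hs c hcg c' hc'g hcc'])
        have hffree := hplanefree f hf hfX (by
          intro a' ha' _ d hd hfad hcls
          have ha'a : a' = a := haonly a' ha'
          subst ha'a
          rcases hmem d hd with rfl | rfl
          · rw [Finset.pair_comm] at hcls
            exact hpencil d hcmem a' haP c' hc'P (fun h => (Finset.mem_filter.1 hcmem).2.2 (h ▸ haL)) hcc'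
              (fun h => (Finset.mem_filter.1 hc'mem).2.2 (h ▸ haL)) hcls hccls
          · rw [Finset.pair_comm] at hcls hccls
            exact hpencil d hc'mem a' haP c hcP (fun h => (Finset.mem_filter.1 hc'mem).2.2 (h ▸ haL))
              (Ne.symm hcc') (fun h => (Finset.mem_filter.1 hcmem).2.2 (h ▸ haL)) hcls hccls)
        exact ⟨f, hffree.1, hffree.2⟩
      · -- the line `{c, c'}` is not a class line: a spine point of `W` off `clF M` is free
        have hLW2 : 1 < (Lset.filter (fun e => e ∈ W)).card := by omega
        obtain ⟨s, hsm, s', hs'm, hss'⟩ := Finset.one_lt_card.1 hLW2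
        rw [Finset.mem_filter] at hsm hs'm
        by_cases hsM : s ∈ clF M Mset
        · have hs'M : s' ∉ clF M Mset := hLM s hsm.1 s' hs'm.1 hss' hsM
          exact ⟨s', hs'm.2, hspinefree s' hs'm.2 (Finset.mem_filter.1 hs'm.1).2 hs'M
            (fun _ h => absurd h hccls)⟩
        · exact ⟨s, hsm.2, hspinefree s hsm.2 (Finset.mem_filter.1 hsm.1).2 hsM (fun _ h => absurd h hccls)⟩
  · -- `|P₂| = 3`: `L₀ = ∅`, `|P₃| = 1`; two side points and a free spine point
    right
    have hL₀e : L₀ = ∅ := Finset.card_eq_zero.1 (by omega)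
    have hnoL₀ : ∀ a, a ∉ L₀ := fun a ha => by rw [hL₀e] at ha; exact Finset.notMem_empty _ ha
    have hLWall : ∀ e ∈ Lset, e ∈ W := fun e he => hLW e he (hnoL₀ e)
    obtain ⟨y₃', hy₃'W, hyy, hy₃'side⟩ := htwo (by omega)
    refine ⟨y₃', hy₃'W, hyy, hy₃'side, ?_⟩
    -- at most one class line among the three lines through two points of `P₂`; it meets the spine in `≤ 1` point
    -- pick the spine point off `clF M` and off that line
    -- classify: is there a class pair `{d, d'} ⊆ P₂`?
    by_cases hex : ∃ d ∈ P₂, ∃ d' ∈ P₂, d ≠ d' ∧ rkN M (insert w₀ (insert x {d, d'})) ≤ 3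
    · obtain ⟨d, hd, d', hd', hdd', hcls⟩ := hex
      have hdg : d ∈ gr M := hVg (hPV (Finset.mem_filter.1 hd).1)
      have hd'g : d' ∈ gr M := hVg (hPV (Finset.mem_filter.1 hd').1)
      obtain ⟨s, hsL, hsM, hsX⟩ : ∃ s ∈ Lset, s ∉ clF M Mset ∧ s ∉ clF M {d, d'} := by
        by_contra hcon
        push Not at hcon
        obtain ⟨s₁, hs₁, s₂, hs₂, s₃, hs₃, h12, h13, h23⟩ := Finset.two_lt_card.1 (by omega : 2 < Lset.card)
        rcases Classical.em (s₁ ∈ clF M Mset) with h1 | h1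
        · rcases Classical.em (s₂ ∈ clF M Mset) with h2 | h2
          · exact hLM s₁ hs₁ s₂ hs₂ h12 h1 h2
          · rcases Classical.em (s₃ ∈ clF M Mset) with h3 | h3
            · exact hLM s₁ hs₁ s₃ hs₃ h13 h1 h3
            · exact hLline d hd d' (Finset.mem_filter.1 hd').1 hdd' s₂ hs₂ s₃ hs₃ h23 (hcon s₂ hs₂ h2)
                (hcon s₃ hs₃ h3)
        · rcases Classical.em (s₂ ∈ clF M Mset) with h2 | h2
          · rcases Classical.em (s₃ ∈ clF M Mset) with h3 | h3
            · exact hLM s₂ hs₂ s₃ hs₃ h23 h2 h3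
            · exact hLline d hd d' (Finset.mem_filter.1 hd').1 hdd' s₁ hs₁ s₃ hs₃ h13 (hcon s₁ hs₁ h1)
                (hcon s₃ hs₃ h3)
          · exact hLline d hd d' (Finset.mem_filter.1 hd').1 hdd' s₁ hs₁ s₂ hs₂ h12 (hcon s₁ hs₁ h1)
              (hcon s₂ hs₂ h2)
      refine ⟨s, hLWall s hsL, hfreeL hL₀1 s (hLWall s hsL) (Finset.mem_filter.1 hsL).2 hsM ?_⟩
      intro e he e' he' hee' hsee hcls'
      exfalso
      -- `{e, e'}` is a class pair of `P₂`: by the pencil it is `{d, d'}`, but `s ∉ clF {d, d'}`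
      have hkey : ({e, e'} : Finset α) = {d, d'} := by
        by_contra hneq
        -- some point of `{e, e'}` is off `{d, d'}` or the pairs share exactly one point
        rcases Classical.em (e = d) with rfl | hed
        · rcases Classical.em (e' = d') with rfl | hed'
          · exact hneq rfl
          · exact hpencil e hd d' (Finset.mem_filter.1 hd').1 e' (Finset.mem_filter.1 he').1 hdd' hee'
              (Ne.symm hed') hcls hcls'
        · rcases Classical.em (e = d') with rfl | hed'
          · rcases Classical.em (e' = d) with rfl | he'd
            · exact hneq (Finset.pair_comm _ _)
            · rw [Finset.pair_comm] at hcls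
              exact hpencil e hd' d (Finset.mem_filter.1 hd).1 e' (Finset.mem_filter.1 he').1 (Ne.symm hdd')
                hee' (Ne.symm he'd) hcls hcls'
          · -- `e ∉ {d, d'}`: `e'` is `d` or `d'` (three points only), then two class lines through `e'`
            rcases Classical.em (e' = d) with rfl | he'd
            · rw [Finset.pair_comm] at hcls'
              exact hpencil e' hd e (Finset.mem_filter.1 he).1 d' (Finset.mem_filter.1 hd').1 (Ne.symm hee')
                hdd' (fun h => hed' h) hcls' hcls
            · rcases Classical.em (e' = d') with rfl | he'd'
              · rw [Finset.pair_comm] at hcls hcls'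
                exact hpencil e' hd' e (Finset.mem_filter.1 he).1 d (Finset.mem_filter.1 hd).1 (Ne.symm hee')
                  (Ne.symm hdd') (fun h => hed h) hcls' hcls
              · -- four distinct points of `P₂`: impossible
                have hsub : ({e, e', d, d'} : Finset α) ⊆ P₂ := by
                  intro t ht
                  simp only [Finset.mem_insert, Finset.mem_singleton] at ht
                  rcases ht with rfl | rfl | rfl | rfl
                  · exact he
                  · exact he'
                  · exact hd
                  · exact hd'
                have h4 : ({e, e', d, d'} : Finset α).card = 4 := by
                  rw [Finset.card_insert_of_notMem, Finset.card_insert_of_notMem, Finset.card_pair hdd']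
                  · simp only [Finset.mem_insert, Finset.mem_singleton, not_or]
                    exact ⟨he'd, he'd'⟩
                  · simp only [Finset.mem_insert, Finset.mem_singleton, not_or]
                    exact ⟨hee', hed, hed'⟩
                have := Finset.card_le_card hsub
                omega
      rw [hkey] at hsee
      exact hsX hsee
    · push Not at hex
      -- no class pair in `P₂`: every spine point of `W` off `clF M` is free
      obtain ⟨s₁, hs₁, s₂, hs₂, h12⟩ := Finset.one_lt_card.1 (by omega : 1 < Lset.card)
      by_cases hsM : s₁ ∈ clF M Mset
      · have hs₂M : s₂ ∉ clF M Mset := hLM s₁ hs₁ s₂ hs₂ h12 hsM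
        refine ⟨s₂, hLWall s₂ hs₂, hfreeL hL₀1 s₂ (hLWall s₂ hs₂) (Finset.mem_filter.1 hs₂).2 hs₂M ?_⟩
        intro d hd d' hd' hdd' _ hcls
        exact absurd hcls (not_le.2 (hex d hd d' hd' hdd'))
      · refine ⟨s₁, hLWall s₁ hs₁, hfreeL hL₀1 s₁ (hLWall s₁ hs₁) (Finset.mem_filter.1 hs₁).2 hsM ?_⟩
        intro d hd d' hd' hdd' _ hcls
        exact absurd hcls (not_le.2 (hex d hd d' hd' hdd'))


end PercRepro.Shadow
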